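import Summits.BirchSwinnertonDyer.BirchSwinnertonDyer.Theorems.EisensteinPrimesB11L3Door
import Summits.BirchSwinnertonDyer.Rank1Residual.X2.RouteGSplitDisplay52779b1
import Summits.BirchSwinnertonDyer.Rank1Residual.X11b.ChaPairsMinimality
import Summits.BirchSwinnertonDyer.Rank1Residual.Supersingular.IntModelMinimalityKrausTwoMore
import Summits.BirchSwinnertonDyer.BirchSwinnertonDyer.Theorems.Rank1ResidualX11RankOneReduction
import Summits.BirchSwinnertonDyer.Rank1Residual.Partition.EisensteinKernelCertificate
import HarnessLib

/-!
# Row B11 = cell X2c (rank 1, Eisenstein, `3 ‖ N`), sub-cell `X2.CellCSplitNotGV`: `BSD(219b1, 3)` in the kernel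
# on the PARITY-FREE, PREPRINT-FREE road «lever L3» (Kato–Wuthrich + Stein–Wuthrich + the pair's 3-adic
# certificate), modulo PUBLISHED facts + the pair's instrument readings (cell `bsd-eis`, seat `bsd-eis-k5-p3`
# gen 0, D-0131 (3) middle tier; route `EisensteinPrimes`, crux 4 `BSDpOnCellC` = `X2.TargetC` =
# stmt-BirchSwinnertonDyer-19034; THEOREMS ONLY; generated by `work/cells/gen_l3.py` from Cremona `ecdata` +
# the O9 atlas; membership template = k5-c4 g8's `gen_display.py` / p427884)

HONEST FRAMING (FULL-BSD rank-≤1 programme D-0033, cell `bsd-eis`, home `run/shared/lean/pub/bsd-eis/`;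
row B11 = X2c: 12 665 census cells `(E, p)` with `r_an = 1`, `p` odd, `p ‖ N`, `E[p]` reducible; O9 atlas
`class-closure/O9/E2-hypotheses.tsv`). Nothing is booked here and no label or count moves: X2c stays
CONSTRUCTION-SHAPED as a class; BSD is proved for no curve by this file unconditionally. This file runs ONE
pair through the door `B11L3.bsdp_of_cellC_of_split_of_thm16_of_l3Certificate`
(`Theorems/EisensteinPrimesB11L3Door.lean`, p534013) = the datum-free form of the tree's lever L3
`Typed.X2.bsdp_of_thm16mult_split_of_canonical_certificate`: `CellC W 3` ∧ `split at 3` ∧ [the 3-adic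
certificate for THE split Mazur–Tate–Teitelbaum 3-adic L-function and THE Stein–Wuthrich §4.2 height] ∧ `3 ∤ #Ш_an` ⟹ `BSD(E,3)` — Kato–Wuthrich
divisibility at a REDUCIBLE multiplicative prime (Wuthrich 2014 Thm. 16: no image / parity / anomaly
hypothesis) + the algebraic leading term (Stein–Wuthrich 2013 Thm. 6.1) + Gross–Zagier–Kolyvagin. NO
Greenberg–Vatsal parity (this pair is ψ-even), NO main-conjecture equality, NO λ-minimality, NO partner /
relative / twist, NO anticyclotomic object, NO Schneider hypothesis, NO preprint, NO crux 3: KELLER–YIN-FREE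
(the pair's only booking of record is `literal:T-EISX2LZ` = literal on Keller–Yin 2024 Thm. D [PRE], referee B
R678).

TARGET `W = 219b1 = [0, 1, 1, 3, 2]` (Cremona `allcurves`, reduced minimal model): `N = 219 = 3·73`,
`Δ = -1971` (`|Δ| = 3³·73`), `c₄ = -128`, `c₆ = -1144`; Cremona `allcurves`/`allbsd`/`allgens`: `r = 1`,
`#E(ℚ)_tors = 3`, `∏ c_v = 3`, `Ω = 3.05751614844061`, `L'(E,1) = 1.28032149916641`, `Reg = 1.25623686385375`, `Ш_an = 1.00000000000000`, generator
`P = [2:4:1]`; isogeny class `219b` (Cremona `allisog`: curves [0,1,1,3,2], degree matrix [[0,1,1,3,2],[0,1,1,-27,-85]]).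
O9 atlas row `219b1@3`: sub-cell `split-notGV = Summit.BirchSwinnertonDyer.Rank1Residual.X2.CellCSplitNotGV`; `ord_3 #Ш_an = 0`.

KERNEL-PROVED (ellipticity, global minimality, SPLIT multiplicative at `3` — these three REUSED BY NAME from
`X2/RouteGSplitDisplay52779b1.lean`, where `219b1` is the λ-minimal relative; the rest here, no hypothesis): `W[3]` is reducible (the rational
`Ψ₃`-root `x₀ = 0` with `Ψ₂Sq(x₀) = 9 ≠ 0` spans a rational `3`-line); hence `ClassX2 W 3`, and
`CellC W 3` given the rank.
PER-PAIR INSTRUMENT HYPOTHESES LEFT (readings, not mathematics of this file): `hr : r_an(W) = 1` [Cremona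
`allbsd`; PARI `ellanalyticrank`]; `hcert` : for THE split Mazur–Tate–Teitelbaum 3-adic L-function `L` (`IsSplitMultPAdicLFunctionOf f 3 L`) and THE §4.2 height `Dh`
(`IsSplitMultCanonical Dh Dq`): `ord_{T=0} L = 2` AND `v₃(ϖ·[T²]L·log₃(γ_cyc)²·#E(ℚ)_tors²) = v₃(𝓛₃·∏c_v·Reg₃(E,Dh))`
— i.e. the 3-adic BSD quotient `S₃` (Stein–Wuthrich Conj. 5.1) is a 3-adic UNIT at the pair [instruments of
record for exactly these readings at `3 ‖ N`: bsd-formula-census REG-MULT (two-engine canonical heights,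
`ttrl/bsd-formula-census/REGMULT-TABLE.md`) and b2b-bsdres-x11b `p3cert/` ENGINE 1 (PARI `ellpadicbsd` /
`ellpadicregulator`) ‖ ENGINE 2 (msengine + `swreg.py`); this seat's engine-1 smoke = kit j279787 row
`219b1@3`; a second engine on this pair is OWED before any booking and is named, not claimed];
`hsha : 3 ∤ #Ш_an` [Cremona `allbsd`: `Ш_an = 1.00000000000000`]. CLASS-LEVEL INPUTS, all REGISTERED Literature facts [PUB]
BY NAME: `hWu` Wuthrich 2014 Thm. 16, `hJs` Stein–Wuthrich 2013 Thm. 6.1 (split), `hGZ` Gross–Zagier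
I.7.3, `hGZK` rank part of BSD in analytic rank ≤ 1, `hpar` modular parametrisation. No `_OPEN` fact, no
`@[conjecture]`, no flag-carrying fact.

What this is NOT: not a booking of `(219b1, 3)` (referee word + second engine needed); not the crux
`BSDpOnCellC` (which is the CLASS); not road H / line b1 (the class-wide construction).
Refs: [Wuthrich2014] Thm. 16 (p. 397); [SteinWuthrich2013] Thm. 6.1 (p. 20), §4.2, Conj. 5.1;
[SilvermanAEC2009] VII.1 Rem. 1.1, VII.5 Prop. 5.1(b), Ex. 3.7; [Kraus1989] Prop. 1–2; [Miller2011LMS]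
Def. 1.1; Cremona `ecdata` (allcurves / allbsd / allgens / allisog, class 219b).
-/

set_option autoImplicit false
set_option linter.dupNamespace false

noncomputable section

open scoped Classical MatrixGroups ModularForm

open WeierstrassCurve NumberField IsDedekindDomain Polynomial CongruenceSubgroup PowerSeries
  Literature.NumberTheory.EllipticCurves
  Literature.NumberTheory.EllipticCurves.ModularForms
  Literature.NumberTheory.EllipticCurves.Rank1Residual
  Literature.NumberTheory.EllipticCurves.Rank1Residual.Typed
  Literature.NumberTheory.EllipticCurves.Wuthrich2014
  Literature.NumberTheory.EllipticCurves.SteinWuthrich2013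
  Summit.BirchSwinnertonDyer.BirchSwinnertonDyer.Rank1Residual.IntModel
  Summit.BirchSwinnertonDyer.BirchSwinnertonDyer.Rank1Residual.X11RankOne
  Summit.BirchSwinnertonDyer.Rank1Residual.X11b
  Summit.BirchSwinnertonDyer.Rank1Residual
  Summit.BirchSwinnertonDyer.Rank1Residual.X2
  Summit.BirchSwinnertonDyer.BirchSwinnertonDyer.Theorems.B11L3

namespace Summit.BirchSwinnertonDyer.BirchSwinnertonDyer.Theorems.B11L3Cert219b1

/-! ## §1 The equation: elliptic, globally minimal, SPLIT multiplicative at `3` — ALREADY IN THE TREE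

`219b1` is the λ-minimal RELATIVE of the A10 route-G display `X2/RouteGSplitDisplay52779b1.lean` (ky g3,
p-id of record in TARGET §7 row A10): `isElliptic_219b1`, `isGloballyMinimal_219b1`, `split_219b1` are REUSED
from that module by name (gate `dedup.landed`, p535124), not restated. -/

open Summit.BirchSwinnertonDyer.Rank1Residual.X2.RouteGSplitDisplay52779b1
  (isElliptic_219b1 isGloballyMinimal_219b1 split_219b1)

/-! ## §2 The Galois side: `219b1[3]` is reducible -/

/-- **`219b1[3]` is reducible — IN THE KERNEL**: `x₀ = 0` is a rational root of `Ψ₃` with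
`Ψ₂Sq(x₀) = 9 ≠ 0` (it spans a rational `3`-line = the kernel of the rational `3`-isogeny inside
class `219b`). [cite: SilvermanAEC2009, Ex. 3.7 and III.2.3] -/
theorem not_irreducible_219b1 : ¬ (⟨0, 1, 1, 3, 2⟩ : WeierstrassCurve ℚ).HasIrreducibleModPGaloisRep 3 := by
  haveI := isElliptic_219b1
  obtain ⟨Φ, P, y, h, hΦ, -⟩ :=
    KernelDisc.exists_isRationalLine_of_eval_Ψ₃_eq_zero (W := ⟨0, 1, 1, 3, 2⟩) (0)
      (by norm_num [WeierstrassCurve.Ψ₃, WeierstrassCurve.b₂, WeierstrassCurve.b₄, WeierstrassCurve.b₆,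
            WeierstrassCurve.b₈])
      (by rw [KernelDisc.eval_Ψ₂Sq]; norm_num [WeierstrassCurve.b₂, WeierstrassCurve.b₄, WeierstrassCurve.b₆])
  exact not_hasIrreducibleModPGaloisRep_of_isRationalLine hΦ

/-- **`(219b1, 3)` lies in class X2** (`3` odd, `E[3]` reducible, `3 ‖ N` multiplicative) — in the kernel.
[folklore] -/
theorem classX2_219b1 : ClassX2 (⟨0, 1, 1, 3, 2⟩ : WeierstrassCurve ℚ) 3 :=
  ⟨by decide, not_irreducible_219b1, split_219b1.hasMultiplicativeReductionAtPrime⟩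

/-! ## §3 The display: `BSD(219b1, 3)` on lever L3 (split door) -/

/-- **X2c INSTANCE — `BSD(219b1, 3)`** (row B11, sub-cell `X2.CellCSplitNotGV`: `r_an = 1`, Eisenstein, SPLIT
multiplicative `3 ‖ N = 219`, ψ-even), by the door `B11L3.bsdp_of_cellC_of_split_of_thm16_of_l3Certificate`
(lever L3: Wuthrich 2014 Thm. 16 `I·char_Λ X ∣ (L_3)` + Stein–Wuthrich 2013 Thm. 6.1 split + GZK); `CellC W 3`
holds in the kernel given the rank (`classX2_219b1`), `split_219b1` is the sign. CONDITIONAL only on the per-pair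
INSTRUMENT readings `hr : r_an = 1`, `hcert` (for THE split Mazur–Tate–Teitelbaum function and THE §4.2 height:
`ord_{T=0} L = 2` and `v₃(ϖ·[T²]L·log₃(γ_cyc)²·#tors²) = v₃(𝓛₃·∏c_v·Reg₃)`) and `hsha : 3 ∤ #Ш_an`. No GV parity,
no main-conjecture equality, no partner, no Schneider hypothesis, no `_OPEN` fact, no crux 3. Nothing booked.
[cite: Wuthrich2014, Thm. 16 (p. 397)] [cite: SteinWuthrich2013, Thm. 6.1 (p. 20) and §4.2]
[cite: Miller2011LMS, Def. 1.1 and Prop. 7.6] -/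
theorem bsdp_219b1_at_three_l3
    (hWu : thm16_charIdeal_dvd_multiplicative_of_reducible) (hJs : thm61_splitMultiplicative)
    (hGZ : GrossZagier1986_thm_I_7_3) (hGZK : rank_eq_analyticRank_of_analyticRank_le_one)
    (hpar : nonempty_modularParametrizationData)
    (W : WeierstrassCurve ℚ) [W.IsElliptic] [W.IsGloballyMinimal] (hW : W = ⟨0, 1, 1, 3, 2⟩)
    (hr : W.analyticRank = 1)
    (hcert : ∀ {N : ℕ} [NeZero N] (f : CuspForm (Gamma0 N) 2), IsNewformOf W f →
      ∀ (ϖ : ℚ), (ϖ : ℝ) * W.realPeriodRat = plusPeriod f →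
      ∀ (L : PowerSeries ℚ_[3]), IsSplitMultPAdicLFunctionOf f 3 L →
      ∀ (Dq : TateParameterData W 3) (Dh : PAdicHeightData W 3), IsSplitMultCanonical Dh Dq →
        L.order = ((2 : ℕ) : ℕ∞) ∧
        (((ϖ : ℚ) : ℚ_[3]) * PowerSeries.coeff 2 L *
            (padicLog 3 (cyclotomicGenerator 3) ^ 2 * (W.torsionOrder : ℚ_[3]) ^ 2)).valuation =
          (LInvariant Dq * (W.tamagawaProduct : ℚ_[3]) * padicRegulator Dh).valuation)
    (hsha : ∀ s : ℚ, shaAn W = (s : ℂ) → padicValRat 3 s = 0) :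
    BSDp W 3 := by
  subst hW
  exact bsdp_of_cellC_of_split_of_thm16_of_l3Certificate _ 3 hWu hJs hGZ hGZK hpar ⟨hr, classX2_219b1⟩
    split_219b1 hcert hsha

/-- **The same instance on the route's cell predicate**: `CellC 219b1 3 → BSD(219b1, 3)` modulo the
published facts and the pair's L3 certificate — the pair satisfies crux 4's `X2.TargetC` shape `CellC W p → BSDp W p`
(the analytic-rank clause of `CellC` supplies `hr`). [cite: Wuthrich2014, Thm. 16 (p. 397)]
[cite: SteinWuthrich2013, Thm. 6.1 (p. 20) and §4.2] -/
theorem targetC_219b1_at_three_l3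
    (hWu : thm16_charIdeal_dvd_multiplicative_of_reducible) (hJs : thm61_splitMultiplicative)
    (hGZ : GrossZagier1986_thm_I_7_3) (hGZK : rank_eq_analyticRank_of_analyticRank_le_one)
    (hpar : nonempty_modularParametrizationData)
    (W : WeierstrassCurve ℚ) [W.IsElliptic] [W.IsGloballyMinimal] (hW : W = ⟨0, 1, 1, 3, 2⟩)
    (hcert : ∀ {N : ℕ} [NeZero N] (f : CuspForm (Gamma0 N) 2), IsNewformOf W f →
      ∀ (ϖ : ℚ), (ϖ : ℝ) * W.realPeriodRat = plusPeriod f →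
      ∀ (L : PowerSeries ℚ_[3]), IsSplitMultPAdicLFunctionOf f 3 L →
      ∀ (Dq : TateParameterData W 3) (Dh : PAdicHeightData W 3), IsSplitMultCanonical Dh Dq →
        L.order = ((2 : ℕ) : ℕ∞) ∧
        (((ϖ : ℚ) : ℚ_[3]) * PowerSeries.coeff 2 L *
            (padicLog 3 (cyclotomicGenerator 3) ^ 2 * (W.torsionOrder : ℚ_[3]) ^ 2)).valuation =
          (LInvariant Dq * (W.tamagawaProduct : ℚ_[3]) * padicRegulator Dh).valuation)
    (hsha : ∀ s : ℚ, shaAn W = (s : ℂ) → padicValRat 3 s = 0) :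
    CellC W 3 → BSDp W 3 :=
  fun hc ↦ bsdp_219b1_at_three_l3 hWu hJs hGZ hGZK hpar W hW hc.1 hcert hsha


/-! ## §4 (append, RULING L75 (2) W1a shape) The λ-MINIMAL form of the same certificate: ONE regulator valuation -/

/-- **X2c INSTANCE, λ-minimal form — `BSD(219b1, 3)` from `(μ_an, λ_an) = (0, 2)` and ONE 3-adic regulator
valuation**, by the tree's b2b door `X2.bsdp_of_lamMin_of_regulatorValuation_split` (`X2/RankOneRegulatorBSD.lean`,
eisenstein-p2 gen 5; an `iff`: a computed valuation off the predicted value REFUTES `BSD(E,3)` at the pair). At a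
λ-minimal split pair the L-side readings of §3 (`ord_{T=0} L = 2`, `v₃(ϖ[T²]L) = 0`) follow by algebra from
`(μ, λ) = (0, 2)` (T² ∣ ϖL from L(E,1) = 0 + the exceptional zero; distinguished degree 2 with unit content ⇒
ϖL = T²·unit), so the per-pair instrument hypotheses become: `hr : r_an = 1` [Cremona]; `hμ0 : AnalyticMuLE W 3 0`,
`hlam : AnalyticLambdaEq W 3 2` [window table `O9/LAMMIN-CLASS-typer6.tsv` row `219b1@3`: `(μ_an, λ_an) = (0, 2)`,
engines A PARI `ellpadiclambdamu` ‖ B msengine AGREE — the readings the desk books LM1 on, with λ = 2 instead of 1];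
`hs : #Ш_an = s` [Cremona `allbsd`: `Ш_an = 1`]; and `hReg`: for THE Tate parameter datum and THE Stein–Wuthrich §4.2
height, `v₃(Reg₃(E,Dh)) = 2 + 2·v₃(#tors) − v₃(𝓛₃) − v₃(∏c_v) − v₃(s)` [= 2 + 2 − 2 − 1 − 0 = 1 for this pair;
engine-1 reading kit j279787: Reg₃ = 3 + 3² + 2·3⁴ + O(3⁶), v₃ = 1, v₃(𝓛₃) = 2; two-engine REG-MULT read
(`bsdc_regmult_job.py`) kits j280582–7]. Class-level binders [PUB]: `hWu` Wuthrich 2014 Thm 16, `hJs`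
Stein–Wuthrich 2013 Thm 6.1 (split), `hGZK`, `hpar`. No GV parity, no `_OPEN` fact, no Schneider hypothesis
(it follows), no `p ∤ #Ш_an` hypothesis (the identity carries `v₃(s)`). Nothing booked.
[cite: SteinWuthrich2013, Thm. 6.1 (p. 20) and §4.2] [cite: Wuthrich2014, Thm. 16 (p. 397)]
[cite: Miller2011LMS, Def. 1.1] -/
theorem bsdp_219b1_at_three_lamMin_reg
    (hWu : thm16_charIdeal_dvd_multiplicative_of_reducible) (hJs : thm61_splitMultiplicative)
    (hGZK : rank_eq_analyticRank_of_analyticRank_le_one) (hpar : nonempty_modularParametrizationData)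
    (W : WeierstrassCurve ℚ) [W.IsElliptic] [W.IsGloballyMinimal] (hW : W = ⟨0, 1, 1, 3, 2⟩)
    (hr : W.analyticRank = 1) (hμ0 : AnalyticMuLE W 3 0) (hlam : AnalyticLambdaEq W 3 2)
    (s : ℚ) (hs : shaAn W = (s : ℂ))
    (hReg : ∀ (Dq : TateParameterData W 3) (Dh : PAdicHeightData W 3), IsSplitMultCanonical Dh Dq →
      (padicRegulator Dh).valuation = 2 + 2 * (padicValNat 3 W.torsionOrder : ℤ) -
        (LInvariant Dq).valuation - padicValNat 3 W.tamagawaProduct - padicValRat 3 s) :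
    BSDp W 3 := by
  subst hW
  obtain ⟨Dq⟩ := (nonempty_tateParameterData_iff_holds (W := (⟨0, 1, 1, 3, 2⟩ : WeierstrassCurve ℚ))
    (p := 3)).mpr split_219b1
  obtain ⟨Dh, hDh⟩ := exists_isSplitMultCanonical_holds _ 3 (by decide) Dq
  exact bsdp_of_lamMin_of_regulatorValuation_split hWu hJs hGZK hpar _ 3 (by decide) not_irreducible_219b1 hr
    Dq hDh hμ0 hlam hs (hReg Dq Dh hDh)

end Summit.BirchSwinnertonDyer.BirchSwinnertonDyer.Theorems.B11L3Cert219b1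

end
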